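import Mathlib
import Summits.Ventures.PercRepro2.IFRTail
import Summits.Ventures.PercRepro2.IFRConv
import Summits.Ventures.PercRepro2.IFRSP

/-!
# The balanced-pair and step families for series–parallel flow tails (seat mine-b, cell pub-perc-repro2)

Row B2 of conjectures/MINE-B.md (log-concavity of the max-flow tail) comes with two families that are
equivalent to it at the level of probabilities but are different two-copy statements at the pattern level:
* BAL(a,b): `P(F ≥ a−1)·P(F ≥ b+1) ≤ P(F ≥ a)·P(F ≥ b)` for `a ≤ b` (balanced pairs; the `a = 1` members are
  Reimer's theorem),
* STEP(i,j): `P(F = i)·P(F ≥ j) ≤ P(F = i+1)·P(F ≥ j−1)` for `i + 2 ≤ j` (MINE-B.md §7.6).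
For series–parallel networks both follow from the log-concave tail calculus of `IFRSP.lean`; here they are
recorded as theorems about `SP.tail` (with `IsLCTail.pmf` for `P(F = i)`).
-/

namespace Summit.Ventures.PercRepro2.IFR

/-- BAL for series–parallel tails: `a ≤ b` ⇒ `tail (a−1) · tail (b+1) ≤ tail a · tail b`. -/
theorem SP.tail_balanced (t : SP) {a b : ℤ} (hab : a ≤ b) :
    t.tail (a - 1) * t.tail (b + 1) ≤ t.tail a * t.tail b :=
  (SP.tail_isLCTail t).balanced4 (by omega) (by omega) (by ring)

/-- STEP for series–parallel tails: `i + 2 ≤ j` ⇒ `pmf i · tail j ≤ pmf (i+1) · tail (j−1)`. -/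
theorem SP.tail_step (t : SP) {i j : ℤ} (hij : i + 2 ≤ j) :
    IsLCTail.pmf t.tail i * t.tail j ≤ IsLCTail.pmf t.tail (i + 1) * t.tail (j - 1) := by
  have hF := SP.tail_isLCTail t
  have hz := hF.hazard (show i ≤ i + 1 by omega)
  have hb : t.tail i * t.tail j ≤ t.tail (i + 1) * t.tail (j - 1) :=
    hF.balanced4 (by omega) (by omega) (by ring)
  have hp1 := hF.pmf_nonneg (i + 1)
  have h1 := hF.nonneg (i + 1)
  have hj := hF.nonneg j
  have hj1 := hF.nonneg (j - 1)
  by_cases hpos : 0 < t.tail (i + 1)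
  · -- multiply the hazard inequality by `tail j` and chain with the balanced pair
    have step1 : IsLCTail.pmf t.tail i * t.tail (i + 1) * t.tail j
        ≤ IsLCTail.pmf t.tail (i + 1) * t.tail i * t.tail j :=
      mul_le_mul_of_nonneg_right hz hj
    have step2 : IsLCTail.pmf t.tail (i + 1) * (t.tail i * t.tail j)
        ≤ IsLCTail.pmf t.tail (i + 1) * (t.tail (i + 1) * t.tail (j - 1)) :=
      mul_le_mul_of_nonneg_left hb hp1
    have key : (IsLCTail.pmf t.tail i * t.tail j) * t.tail (i + 1)
        ≤ (IsLCTail.pmf t.tail (i + 1) * t.tail (j - 1)) * t.tail (i + 1) := by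
      calc (IsLCTail.pmf t.tail i * t.tail j) * t.tail (i + 1)
          = IsLCTail.pmf t.tail i * t.tail (i + 1) * t.tail j := by ring
        _ ≤ IsLCTail.pmf t.tail (i + 1) * t.tail i * t.tail j := step1
        _ = IsLCTail.pmf t.tail (i + 1) * (t.tail i * t.tail j) := by ring
        _ ≤ IsLCTail.pmf t.tail (i + 1) * (t.tail (i + 1) * t.tail (j - 1)) := step2
        _ = (IsLCTail.pmf t.tail (i + 1) * t.tail (j - 1)) * t.tail (i + 1) := by ring
    exact le_of_mul_le_mul_right key hpos
  · -- `tail (i+1) = 0` forces `tail j = 0`, so the left side vanishes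
    have hzero : t.tail (i + 1) = 0 := le_antisymm (not_lt.mp hpos) h1
    have hjz : t.tail j = 0 := hF.eq_zero_of_le_zero (show i + 1 ≤ j by omega) hzero
    rw [hjz, mul_zero]
    exact mul_nonneg hp1 hj1

end Summit.Ventures.PercRepro2.IFR
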